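import Summits.CriticalPhenomena.PercolationContinuityZ3.Theorems.PercNearOneGluingNoHeavyQuantFarSunWitnessAvg
import Mathlib.Algebra.BigOperators.Group.Finset.Powerset
import HarnessLib

/-!
# FAR beyond trees: the averaged witness weight SPLIT into mass and boost, and the CHARGING criterion for `G_avg ≥ 1`

builds on p205010 (kernel theorem, internal audit signed; external expert review pending)

Support file (`--supports stmt-CriticalPhenomena-4575`), seat `prim-cert-1` (gen 37); memo `prim-cert-1/FROM-prim-cert-1-g37-SURPLUS-FAR.md` §5–§7.
For the uniform witness kernel of `…QuantFarSunWitnessAvg` (p376210) the weight `G_avg = witGavg K h j` splits as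
`G_avg = P(wit ≠ ∅) + Σ_k Σ_{Q ∌ k} hairW K h Q · w(Q ∪ {k}, k)` ("mass + boost": a CLOSED hair `k` earns the kernel mass it would carry if it
were open — the pivotal form of the memo), provided no hair is dead (`h k > 0`).  Since `1 = P(wit ≠ ∅) + P(wit = ∅)`, `G_avg ≥ 1` amounts to
`boost ≥ deficit := P(wit = ∅)`, and a pattern with empty witness set has at most `2j` members (`HairyCycle.card_le_of_wit_not_nonempty`), so the
deficit can be CHARGED to closed hairs with any position weights `ω ≥ 0`:  if `Σ_{k ∉ H} ω_k ≥ Ω₀ > 0` for every pattern `H ⊆ range K` with empty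
witness set, then `deficit ≤ Ω₀⁻¹ Σ_k ω_k · d_k` with `d_k = Σ_{Q ∌ k, wit Q = ∅} hairW Q`, and the termwise comparison `ω_k d_k ≤ Ω₀ a_k`
(`a_k` the boost of `k`) gives `G_avg ≥ 1` (**`HairyCycle.witGavg_ge_one_of_charging`**).  This is the criterion behind (Ω)/(Ω′) of the memo and the
route to "(S-avg) for all large `K`" (memo §7).

* `HairyCycle.wit_nonempty_of_card` / `card_le_of_wit_not_nonempty` — `#Q ≥ 2j+1 ⇒ wit j Q ≠ ∅`.
* `HairyCycle.hairW_eq_mul_erase`, `hairW_insert_eq_mul_erase` — removing hair `k`'s factor: with `h⁰ = Function.update h k 0`,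
  `hairW K h Q = (1 − h k)·hairW K h⁰ Q` and `hairW K h (insert k Q) = h k·hairW K h⁰ Q` for `k ∉ Q`, `k < K`.
* **`HairyCycle.witGavg_eq_mass_add_boost`** — the split (for `0 < h k`, `k < K`).
* **`HairyCycle.witGavg_ge_one_of_charging`** — the charging criterion.
No definitions, no sorries, standard axioms.  Elementary [this work].
-/

noncomputable section

namespace Summit.CriticalPhenomena.PercolationContinuityZ3.Theorems.HairyCycle

open Finset
open scoped Classical

variable {K : ℕ}

/-! ## Patterns with at least `2j+1` members have a witness -/

/-- A pattern with at least `2j+1` members has a witness: the least member `d` with at least `j` members below it has exactly `j` below and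
hence at least `j` above. [this work] -/
theorem wit_nonempty_of_card {j : ℕ} {Q : Finset ℕ} (hQ : 2 * j + 1 ≤ Q.card) : (wit j Q).Nonempty := by
  -- candidates: members with at least `j` members of `Q` below them
  set S := Q.filter (fun d => j ≤ (Q.filter fun e => e < d).card) with hS
  have hQne : Q.Nonempty := Finset.card_pos.1 (by omega)
  -- the maximum of `Q` is a candidate
  have hmaxS : Q.max' hQne ∈ S := by
    rw [hS, Finset.mem_filter]
    refine ⟨Finset.max'_mem Q hQne, ?_⟩
    have hsub : Q.erase (Q.max' hQne) ⊆ Q.filter fun e => e < Q.max' hQne := by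
      intro e he
      rw [Finset.mem_erase] at he
      rw [Finset.mem_filter]
      exact ⟨he.2, lt_of_le_of_ne (Finset.le_max' Q e he.2) he.1⟩
    have := Finset.card_le_card hsub
    rw [Finset.card_erase_of_mem (Finset.max'_mem Q hQne)] at this
    omega
  have hSne : S.Nonempty := ⟨_, hmaxS⟩
  set d := S.min' hSne with hd
  have hdS : d ∈ S := Finset.min'_mem S hSne
  rw [hS, Finset.mem_filter] at hdS
  obtain ⟨hdQ, hbelow⟩ := hdS
  -- exactly `j` members below `d`
  have hbelow_eq : (Q.filter fun e => e < d).card = j := by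
    by_contra hne
    have hgt : j + 1 ≤ (Q.filter fun e => e < d).card := by omega
    have hne' : (Q.filter fun e => e < d).Nonempty := Finset.card_pos.1 (by omega)
    set d' := (Q.filter fun e => e < d).max' hne' with hd'
    have hd'mem : d' ∈ Q.filter fun e => e < d := Finset.max'_mem _ hne'
    rw [Finset.mem_filter] at hd'mem
    -- `d'` is a candidate below `d`: contradiction with minimality
    have hd'S : d' ∈ S := by
      rw [hS, Finset.mem_filter]
      refine ⟨hd'mem.1, ?_⟩
      have hsub : (Q.filter fun e => e < d).erase d' ⊆ Q.filter fun e => e < d' := by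
        intro e he
        rw [Finset.mem_erase, Finset.mem_filter] at he
        rw [Finset.mem_filter]
        refine ⟨he.2.1, lt_of_le_of_ne ?_ he.1⟩
        exact Finset.le_max' _ e (Finset.mem_filter.2 he.2)
      have := Finset.card_le_card hsub
      rw [Finset.card_erase_of_mem (Finset.mem_filter.2 hd'mem)] at this
      omega
    have := Finset.min'_le S d' hd'S
    rw [← hd] at this
    exact absurd hd'mem.2 (not_lt.2 this)
  -- hence at least `j` members above `d`
  refine ⟨d, Finset.mem_filter.2 ⟨hdQ, hbelow, ?_⟩⟩
  have hsplit : Q.card = (Q.filter fun e => e < d).card + ((Q.filter fun e => d < e).card + 1) := by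
    have h1 : Q = (Q.filter fun e => e < d) ∪ ((Q.filter fun e => d < e) ∪ {d}) := by
      ext e
      simp only [Finset.mem_union, Finset.mem_filter, Finset.mem_singleton]
      constructor
      · intro he
        rcases lt_trichotomy e d with h | h | h
        · exact Or.inl ⟨he, h⟩
        · exact Or.inr (Or.inr h)
        · exact Or.inr (Or.inl ⟨he, h⟩)
      · rintro (⟨he, _⟩ | ⟨he, _⟩ | rfl)
        · exact he
        · exact he
        · exact hdQ
    have hdisj1 : Disjoint (Q.filter fun e => e < d) ((Q.filter fun e => d < e) ∪ {d}) := by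
      rw [Finset.disjoint_left]
      intro e he he'
      rw [Finset.mem_filter] at he
      rw [Finset.mem_union, Finset.mem_filter, Finset.mem_singleton] at he'
      rcases he' with ⟨_, h⟩ | h
      · exact lt_asymm he.2 h
      · exact absurd he.2 (h ▸ lt_irrefl e)
    have hdisj2 : Disjoint (Q.filter fun e => d < e) ({d} : Finset ℕ) := by
      rw [Finset.disjoint_singleton_right, Finset.mem_filter]
      exact fun h => lt_irrefl d h.2
    conv_lhs => rw [h1]
    rw [Finset.card_union_of_disjoint hdisj1, Finset.card_union_of_disjoint hdisj2, Finset.card_singleton]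
  omega

/-- A pattern with empty witness set has at most `2j` members. [this work] -/
theorem card_le_of_wit_not_nonempty {j : ℕ} {Q : Finset ℕ} (hQ : ¬ (wit j Q).Nonempty) : Q.card ≤ 2 * j := by
  by_contra h
  exact hQ (wit_nonempty_of_card (by omega))

/-! ## Removing one hair's factor -/

/-- For `k ∉ Q`: `hairW K h Q = (1 − h k)·hairW K h⁰ Q` where `h⁰ = update h k 0` (`k < K`). [this work] -/
theorem hairW_eq_mul_erase (h : ℕ → ℝ) {k : ℕ} (hk : k < K) {Q : Finset ℕ} (hkQ : k ∉ Q) :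
    hairW K h Q = (1 - h k) * hairW K (Function.update h k 0) Q := by
  unfold hairW
  rw [← Finset.mul_prod_erase (range K) _ (Finset.mem_range.2 hk), ← Finset.mul_prod_erase (range K) (fun x => if x ∈ Q then Function.update h k 0 x else 1 - Function.update h k 0 x) (Finset.mem_range.2 hk)]
  simp only [if_neg hkQ, Function.update_self, sub_zero, one_mul]
  congr 1
  refine Finset.prod_congr rfl fun i hi => ?_
  have hik : i ≠ k := Finset.ne_of_mem_erase hi
  rw [Function.update_of_ne hik]

/-- For `k ∉ Q`: `hairW K h (insert k Q) = h k·hairW K h⁰ Q` where `h⁰ = update h k 0` (`k < K`). [this work] -/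
theorem hairW_insert_eq_mul_erase (h : ℕ → ℝ) {k : ℕ} (hk : k < K) {Q : Finset ℕ} (hkQ : k ∉ Q) :
    hairW K h (insert k Q) = h k * hairW K (Function.update h k 0) Q := by
  unfold hairW
  rw [← Finset.mul_prod_erase (range K) _ (Finset.mem_range.2 hk), ← Finset.mul_prod_erase (range K) (fun x => if x ∈ Q then Function.update h k 0 x else 1 - Function.update h k 0 x) (Finset.mem_range.2 hk)]
  simp only [Finset.mem_insert_self, if_true, if_neg hkQ, Function.update_self, sub_zero, one_mul]
  congr 1
  refine Finset.prod_congr rfl fun i hi => ?_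
  have hik : i ≠ k := Finset.ne_of_mem_erase hi
  rw [Function.update_of_ne hik]
  simp only [Finset.mem_insert, hik, false_or]

/-! ## The split of `G_avg` -/

/-- The uniform kernel's total mass on a pattern with a witness is exactly one. [this work] -/
theorem sum_witAvgKernel_eq (j : ℕ) {Q : Finset ℕ} (hQ : (wit j Q).Nonempty) : ∑ k ∈ Q, witAvgKernel j Q k = 1 := by
  have hcard : (0 : ℝ) < (wit j Q).card := by exact_mod_cast Finset.card_pos.2 hQ
  have hsub : wit j Q ⊆ Q := fun d hd => mem_of_mem_wit hd
  rw [← Finset.sum_subset hsub (fun k _ hk => by unfold witAvgKernel; rw [if_neg hk])]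
  have : ∑ k ∈ wit j Q, witAvgKernel j Q k = ∑ k ∈ wit j Q, 1 / ((wit j Q).card : ℝ) :=
    Finset.sum_congr rfl fun k hk => by unfold witAvgKernel; rw [if_pos hk]
  rw [this, Finset.sum_const, nsmul_eq_mul, mul_one_div, div_self hcard.ne']

/-- The uniform kernel vanishes on a pattern without witnesses. [this work] -/
theorem sum_witAvgKernel_eq_zero (j : ℕ) {Q : Finset ℕ} (hQ : ¬ (wit j Q).Nonempty) (s : Finset ℕ) : ∑ k ∈ s, witAvgKernel j Q k = 0 :=
  Finset.sum_eq_zero fun k _ => by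
    unfold witAvgKernel
    rw [if_neg (fun hk => hQ ⟨k, hk⟩)]

/-- **`G_avg = mass + boost`.**  If no hair is dead (`0 < h k` for `k < K`), then
`witGavg K h j = Σ_{Q} hairW K h Q·𝟙[wit j Q ≠ ∅] + Σ_{k<K} Σ_{Q ⊆ range K ∖ {k}} hairW K h Q · witAvgKernel j (insert k Q) k`
(the mass of the kernel plus, for every CLOSED hair `k`, the kernel mass `k` would carry if opened). [this work] -/
theorem witGavg_eq_mass_add_boost {h : ℕ → ℝ} (hpos : ∀ k, k < K → 0 < h k) (j : ℕ) :
    witGavg K h j = ∑ Q ∈ (range K).powerset, hairW K h Q * (if (wit j Q).Nonempty then 1 else 0) +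
      ∑ k ∈ range K, ∑ Q ∈ ((range K).erase k).powerset, hairW K h Q * witAvgKernel j (insert k Q) k := by
  unfold witGavg witGW witMassW
  -- per position: split the pattern sum at hair `k`
  have hk_term : ∀ k ∈ range K, (∑ Q ∈ (range K).powerset, hairW K h Q * witAvgKernel j Q k) / h k =
      ∑ Q ∈ ((range K).erase k).powerset, hairW K h (insert k Q) * witAvgKernel j (insert k Q) k +
        ∑ Q ∈ ((range K).erase k).powerset, hairW K h Q * witAvgKernel j (insert k Q) k := by
    intro k hk
    have hkK := Finset.mem_range.1 hk
    have hkS : k ∉ (range K).erase k := Finset.notMem_erase k _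
    have hins : insert k ((range K).erase k) = range K := Finset.insert_erase hk
    rw [← hins, Finset.sum_powerset_insert hkS, hins]
    -- patterns without `k` carry no kernel mass at `k`
    have h0 : ∑ Q ∈ ((range K).erase k).powerset, hairW K h Q * witAvgKernel j Q k = 0 :=
      Finset.sum_eq_zero fun Q hQ => by
        rw [Finset.mem_powerset] at hQ
        have hkQ : k ∉ Q := fun hm => hkS (hQ hm)
        unfold witAvgKernel
        rw [if_neg (fun hw => hkQ (mem_of_mem_wit hw)), mul_zero]
    rw [h0, zero_add, Finset.sum_div, ← Finset.sum_add_distrib]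
    refine Finset.sum_congr rfl fun Q hQ => ?_
    rw [Finset.mem_powerset] at hQ
    have hkQ : k ∉ Q := fun hm => hkS (hQ hm)
    -- `hairW (insert k Q) / h k = hairW⁰ Q = hairW (insert k Q) + hairW Q`
    rw [hairW_insert_eq_mul_erase h hkK hkQ, hairW_eq_mul_erase h hkK hkQ]
    have hne : h k ≠ 0 := (hpos k hkK).ne'
    field_simp
    ring
  rw [Finset.sum_congr rfl hk_term, Finset.sum_add_distrib]
  congr 1
  -- the mass: `Σ_k Σ_{Q ∌ k} hairW (insert k Q) w (insert k Q) k = Σ_Q hairW Q Σ_{k ∈ Q} w Q k`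
  have hre : ∀ k ∈ range K, ∑ Q ∈ ((range K).erase k).powerset, hairW K h (insert k Q) * witAvgKernel j (insert k Q) k =
      ∑ Q ∈ (range K).powerset, hairW K h Q * (if k ∈ Q then witAvgKernel j Q k else 0) := by
    intro k hk
    have hkS : k ∉ (range K).erase k := Finset.notMem_erase k _
    have hins : insert k ((range K).erase k) = range K := Finset.insert_erase hk
    conv_rhs => rw [← hins, Finset.sum_powerset_insert hkS]
    have h0 : ∑ Q ∈ ((range K).erase k).powerset, hairW K h Q * (if k ∈ Q then witAvgKernel j Q k else 0) = 0 :=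
      Finset.sum_eq_zero fun Q hQ => by
        rw [Finset.mem_powerset] at hQ
        rw [if_neg (fun hm => hkS (hQ hm)), mul_zero]
    rw [h0, zero_add]
    refine Finset.sum_congr rfl fun Q _ => ?_
    rw [if_pos (Finset.mem_insert_self k Q)]
  rw [Finset.sum_congr rfl hre, Finset.sum_comm]
  refine Finset.sum_congr rfl fun Q hQ => ?_
  rw [Finset.mem_powerset] at hQ
  rw [← Finset.mul_sum]
  congr 1
  rw [← Finset.sum_filter, Finset.filter_mem_eq_inter, Finset.inter_eq_right.2 hQ]
  by_cases hne : (wit j Q).Nonempty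
  · rw [if_pos hne, sum_witAvgKernel_eq j hne]
  · rw [if_neg hne, sum_witAvgKernel_eq_zero j hne]

/-! ## The charging criterion -/

/-- **CHARGING CRITERION for `G_avg ≥ 1`.**  Let `0 < h k ≤ 1` (`k < K`), position weights `ω` (any reals) and `Ω₀ > 0` with
`Ω₀ ≤ Σ_{k ∈ range K ∖ H} ω k` for every pattern `H ⊆ range K` WITHOUT a witness (at most `2j` members).  If for every `k < K`
`ω k · d_k ≤ Ω₀ · a_k`, where `d_k = Σ_{Q ⊆ range K ∖ {k}, wit Q = ∅} hairW K h Q` (hair `k` closed, no witness) and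
`a_k = Σ_{Q ⊆ range K ∖ {k}} hairW K h Q · witAvgKernel j (insert k Q) k` (the boost of `k`), then `witGavg K h j ≥ 1`. [this work] -/
theorem witGavg_ge_one_of_charging {h : ℕ → ℝ} (hh : ∀ k, k < K → 0 < h k ∧ h k ≤ 1) (j : ℕ) (ω : ℕ → ℝ)
    {Ω₀ : ℝ} (hΩ : 0 < Ω₀)
    (hcov : ∀ H, H ⊆ range K → ¬ (wit j H).Nonempty → Ω₀ ≤ ∑ k ∈ range K \ H, ω k)
    (hcmp : ∀ k, k < K →
      ω k * ∑ Q ∈ ((range K).erase k).powerset, hairW K h Q * (if (wit j Q).Nonempty then 0 else 1) ≤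
        Ω₀ * ∑ Q ∈ ((range K).erase k).powerset, hairW K h Q * witAvgKernel j (insert k Q) k) :
    1 ≤ witGavg K h j := by
  have hh' : ∀ k, k < K → 0 ≤ h k ∧ h k ≤ 1 := fun k hk => ⟨(hh k hk).1.le, (hh k hk).2⟩
  rw [witGavg_eq_mass_add_boost (fun k hk => (hh k hk).1) j]
  -- `1 = mass + deficit`
  have htot : ∑ Q ∈ (range K).powerset, hairW K h Q * (if (wit j Q).Nonempty then (1 : ℝ) else 0) +
      ∑ Q ∈ (range K).powerset, hairW K h Q * (if (wit j Q).Nonempty then (0 : ℝ) else 1) = 1 := by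
    rw [← Finset.sum_add_distrib]
    calc ∑ Q ∈ (range K).powerset, (hairW K h Q * (if (wit j Q).Nonempty then (1 : ℝ) else 0) +
            hairW K h Q * (if (wit j Q).Nonempty then (0 : ℝ) else 1))
        = ∑ Q ∈ (range K).powerset, hairW K h Q := Finset.sum_congr rfl fun Q _ => by split_ifs <;> ring
      _ = 1 := sum_hairW_eq_one h
  -- deficit ≤ Ω₀⁻¹ Σ_k ω_k d_k
  have hdef : ∑ Q ∈ (range K).powerset, hairW K h Q * (if (wit j Q).Nonempty then (0 : ℝ) else 1) ≤
      (∑ k ∈ range K, ω k * ∑ Q ∈ ((range K).erase k).powerset, hairW K h Q * (if (wit j Q).Nonempty then 0 else 1)) / Ω₀ := by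
    rw [le_div_iff₀ hΩ]
    -- rewrite the right side as a pattern sum
    have hre : ∀ k ∈ range K, ω k * ∑ Q ∈ ((range K).erase k).powerset, hairW K h Q * (if (wit j Q).Nonempty then (0 : ℝ) else 1) =
        ∑ Q ∈ (range K).powerset, hairW K h Q * (if (wit j Q).Nonempty then (0 : ℝ) else 1) * (if k ∈ Q then 0 else ω k) := by
      intro k hk
      have hkS : k ∉ (range K).erase k := Finset.notMem_erase k _
      have hins : insert k ((range K).erase k) = range K := Finset.insert_erase hk
      conv_rhs => rw [← hins, Finset.sum_powerset_insert hkS]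
      have h0 : ∑ Q ∈ ((range K).erase k).powerset,
          hairW K h (insert k Q) * (if (wit j (insert k Q)).Nonempty then (0 : ℝ) else 1) * (if k ∈ insert k Q then 0 else ω k) = 0 :=
        Finset.sum_eq_zero fun Q _ => by rw [if_pos (Finset.mem_insert_self k Q), mul_zero]
      rw [h0, add_zero, Finset.mul_sum]
      refine Finset.sum_congr rfl fun Q hQ => ?_
      rw [Finset.mem_powerset] at hQ
      rw [if_neg (fun hm => hkS (hQ hm))]
      ring
    rw [Finset.sum_congr rfl hre, Finset.sum_comm, Finset.sum_mul]
    refine Finset.sum_le_sum fun Q hQ => ?_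
    rw [Finset.mem_powerset] at hQ
    rw [← Finset.mul_sum]
    by_cases hne : (wit j Q).Nonempty
    · simp [hne]
    · rw [if_neg hne, mul_one]
      refine mul_le_mul_of_nonneg_left ?_ (hairW_nonneg hh' Q)
      have e : ∑ k ∈ range K, (if k ∈ Q then (0 : ℝ) else ω k) = ∑ k ∈ range K \ Q, ω k := by
        rw [← Finset.sum_sdiff hQ]
        have h1 : ∑ k ∈ Q, (if k ∈ Q then (0 : ℝ) else ω k) = 0 := Finset.sum_eq_zero fun k hk => if_pos hk
        have h2 : ∑ k ∈ range K \ Q, (if k ∈ Q then (0 : ℝ) else ω k) = ∑ k ∈ range K \ Q, ω k :=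
          Finset.sum_congr rfl fun k hk => if_neg (Finset.mem_sdiff.1 hk).2
        rw [h2, h1, add_zero]
      rw [e]
      exact hcov Q hQ hne
  -- termwise comparison
  have hsum : (∑ k ∈ range K, ω k * ∑ Q ∈ ((range K).erase k).powerset, hairW K h Q * (if (wit j Q).Nonempty then (0 : ℝ) else 1)) / Ω₀ ≤
      ∑ k ∈ range K, ∑ Q ∈ ((range K).erase k).powerset, hairW K h Q * witAvgKernel j (insert k Q) k := by
    rw [div_le_iff₀ hΩ, Finset.sum_mul]
    refine Finset.sum_le_sum fun k hk => ?_
    have := hcmp k (Finset.mem_range.1 hk)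
    linarith
  linarith

end Summit.CriticalPhenomena.PercolationContinuityZ3.Theorems.HairyCycle

end
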